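import Literature.NumberTheory.EllipticCurves.Delbourgo1998.RankZeroLeadingTerm
import Literature.NumberTheory.EllipticCurves.IwasawaSelmerControlLocalizationProofs
import HarnessLib

/-!
# Delbourgo 1998, Thm. 3 + Prop. 4 in the paper's OWN currency: the rank-zero algebraic leading term
# of `X(E/ℚ_∞)` at an additive, potentially good ORDINARY prime — EXACT up to a `p`-adic unit, with the
# local factor at `p` kept INTRINSIC as the order of the local restriction kernel (named fact)

Topic `NumberTheory/EllipticCurves`, sub-directory `Delbourgo1998` (namespace = path). ONE named fact
(`def … : Prop`, D-0014) and nothing else; the (G)-ordinary twin of the accepted (M)-locus fact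
`prop4_rankZero_constantCoeff_eq_unit_mul_of_potMult` (`RankZeroLeadingTermExactPotMult.lean`) and the
EXACT form of the accepted one-direction fact `prop4_rankZero_pow_dvd_constantCoeff`
(`RankZeroLeadingTerm.lean`, which DROPS the local factor at `p` to keep a divisibility). Written for the
cell `bsd-addord` (run/shared/lean/pub/bsd-addord/; seat `bsd-addord-lit` gen 8), planner ruling TARGET.md
S39 item **(H1-b)** («a Literature READING-fact "De98 Thm 3 p. 143 + Prop 4 p. 144 in De98's OWN currency"
— the r0 constant-coefficient formula with the factor `Nat.card (W.localTowerKerPrimary κ_cyc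
(v.adicCompletion ℚ) 0)` in place of De02's `ℓ_p`»; referee pre-audit condition (c6)). The cell's kernel
theorem `Summit.….Additive.GoodModelLine.localTowerKerPrimary_zero_eq_bot_of_goodModel_of_hasAdditiveReductionAt`
(b2b-bsdres row T-T3B) evaluates that factor to `1` at an additive potentially good ordinary prime; this
file asserts NOTHING about its value.

## The printed statements (D. Delbourgo, *Iwasawa theory for elliptic curves at unstable primes*,
Compositio Math. 113 (1998) 123–154; held text `paper:delbourgo1998-…`; pages as printed; pp. 138,
144–148 read on page images by the cell's literature seat, dossier `HOME/lit/delbourgo1998/STATEMENTS.md`)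

* p. 123: `p` an odd prime; `ℚ_∞` the cyclotomic `ℤ_p`-extension, `Γ = Gal(ℚ_∞/ℚ)`, `Λ = ℤ_p⟦Γ⟧ ≅ ℤ_p⟦T⟧`
  (`γ ↦ 1 + T`, p. 151); §2.1 (pp. 136–137): `S(E/ℚ)`, `S(E/ℚ_∞)` the CLASSICAL Selmer groups, `X_∞` the
  Pontryagin dual of `S(E/ℚ_∞)` (the tree's `SelmerDualData`, as in both sibling files).
* §1.5 (p. 130) **Hypothesis (G)**: "`E` has potential good reduction at `p` and `E` possesses good
  reduction over a field `L ⊂ ℚ_p(μ_p)` where `[L : ℚ_p] = d`."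
* §2.2, **p. 138** (the control diagram `α, β, δ`; `δ : ⊕_{ν∈Σ} H¹(ℚ_ν, E)(p) → (⊕_{ν∈Σ_∞} H¹(ℚ_{∞,ν}, E)(p))^Γ`
  the local RESTRICTION map): "We devote the rest of this section to calculating `#Ker(δ)`. **The
  inflation-restriction sequence shows that `Ker(δ) = ⊕_{ν∈Σ} H¹(ℚ_{∞,ν}/ℚ_ν, E(ℚ_{∞,ν}))(p)`, where we
  have fixed a prime of `ℚ_∞` lying above `ν`.** Hence it is sufficient to determine
  `#H¹(ℚ_{∞,ν}/ℚ_ν, E(ℚ_{∞,ν}))(p)`. LEMMA. Assume that `ν ≠ p`. Then `#H¹(ℚ_{∞,ν}/ℚ_ν, E(ℚ_{∞,ν}))(p)` is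
  the `p`-part of `c_ν`, where `c_ν = [E(ℚ_ν) : E₀(ℚ_ν)]` denotes the local Tamagawa factor at `ν`. …
  Now let `𝔭` be the unique prime of `ℚ_∞` lying above `p`. Recall that `p` is totally ramified in `ℚ_∞`
  and that `Gal(ℚ_{∞,𝔭}/ℚ_p) ≅ Γ`."
* §2.3 (p. 143) **Hypothesis (Kol)**: "`E` is modular and its analytic rank `r_E` is zero. … (Kol) implies
  the finiteness of both `E(ℚ)` and the Tate–Shafarevic group." **Theorem 3** (p. 143): "Assume that
  either `E` has potential good ordinary reduction at `p` and satisfies (G), or `E` satisfies (M) and does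
  not have split multiplicative reduction at `p`. Moreover suppose that `E` satisfies the hypothesis
  (Kol). Then the module `X_∞` is `Λ`-torsion. If `G_E` denotes its characteristic power series then the
  leading term `x_p^0(G_E) ≠ 0`."
* **Proposition 4** (p. 144): "Assume that either `E` has potential good ordinary reduction at `p` and
  satisfies (G), or `E` satisfies (M) and does not have split multiplicative reduction at `p`. Again
  suppose that `E` satisfies the hypothesis (Kol). Then
  `x_p^0(G_E) ∼ (#Ш_E(p)/#E(ℚ)²) · #H¹(ℚ_{∞,𝔭}/ℚ_p, E(ℚ_{∞,𝔭})) · ∏_{ν≠p} c_ν`, where `Ш_E` is the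
  Tate–Shafarevic group of `E` over `ℚ`, with `∼` denoting equivalence up to a `p`-adic unit."
* Proof of Prop. 4, **p. 147**: "We know (i) `β` is surjective, (ii) `Ker(β)` is finite with
  `#Ker(β) ∼ #E(ℚ)`, and **(iii) `Ker(δ)` is finite with `#Ker(δ) ∼ #H¹(ℚ_{∞,𝔭}/ℚ_p, E(ℚ_{∞,𝔭})) ∏_{ν≠p} c_ν`.**"
  — the factor at `𝔭` is carried through the proof as `#Ker(δ)_𝔭`; its VALUE (`#𝔉(𝔽_p)·#ℜE(ℚ_p)`, §2.2
  Lemma (i) p. 139) is substituted only afterwards (§2.4, p. 148) and is NOT part of this fact (see the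
  dispute note below).

## The object (pre-audit condition (c6) of the cell's referee)

`#H¹(ℚ_{∞,𝔭}/ℚ_p, E(ℚ_{∞,𝔭}))(p)` is typed as `Nat.card (W.localTowerKerPrimary κ (v.adicCompletion ℚ) 0)`,
the order of the `p`-power torsion of the tree's **local tower kernel at level `0`**,
`𝒦_{E,0} = ker (H¹(H_{E,0}, E(K̄_E)) → H¹(H_{E,∞}, E(K̄_E)))` for `E = ℚ_v` (`v ∋ p`), `H_{E,0} = Γ_{ℚ_v}`,
`H_{E,∞} = Gal(K̄_v/ℚ_vℚ_∞)` (`Literature/NumberTheory/EllipticCurves/IwasawaSelmerControlLocalizationProofs.lean`,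
`WeierstrassCurve.localTowerKer` / `localTowerKerPrimary`, whose docstring reads: "for `E = K_v` these are
the absolute Galois groups of `K_{n,w} = K_nK_v` and `K_{∞,η} = K_∞K_v` inside `K̄_v` …, so that
`𝒦_{E,n} ≅ H¹(Gal(K_{∞,η}/K_{n,w}), E(K_{∞,η}))` (inflation–restriction)"). This is EXACTLY the printed
object: De98's factor is, by the p. 138 sentence quoted above, the `ν = 𝔭` summand of `Ker(δ)`, `δ` the
local restriction map `H¹(ℚ_p, E)(p) → H¹(ℚ_{∞,𝔭}, E)(p)` — the same inflation–restriction identification,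
printed. (`H¹(ℚ_{∞,𝔭}/ℚ_p, E(ℚ_{∞,𝔭}))` is `p`-primary, `Γ` being pro-`p`, so `#H¹(…) = #H¹(…)(p)`.)

## The fact below (case (G)-ordinary; as printed, up to the choice of generator and weaker hypotheses)

`x_p^0(G_E) = G_E(0)` is the constant term of the characteristic power series, a GENERATOR of `char_Λ X_∞`
(principal; tree `charIdeal_isPrincipal_holds`); generators differ by `Λ`-units, whose constant terms are
`p`-adic units, so "some generator `g`" transcribes `G_E`. The prime-to-`p` parts of `#E(ℚ)²`,
`∏_{ν≠p} c_ν` are absorbed in the unit `u`. Hypotheses, weaker than print and IDENTICAL to the sibling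
`prop4_rankZero_pow_dvd_constantCoeff` on its (G) branch: `p ≠ 2`; `E` ADDITIVE at `p`; (G)-ordinary in
the global form of the cell (a `p`-th cyclotomic field `L ⊇ ℚ` and an intermediate field `F` over which
`E` has good reduction with unit root at every place above `p` — implies the printed local (G) with
`[L_w : ℚ_p] = d` and "potential good ordinary reduction at `p`"); (Kol) as `r_an = 0` (modularity is a
theorem) PLUS `Ш(E/ℚ)` and `E(ℚ)` finite as explicit binders (conclusions of (Kol) in print); `κ` the
cyclotomic `ℤ_p`-extension of `ℚ` with topological generator `γ`, `v` the place of `ℚ` above `p`,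
`D : W.SelmerDualData κ γ`. Conclusion: `D.IsTorsion` (Thm. 3); the level-`0` local tower kernel at `v`
is FINITE (p. 147 (iii) "`Ker(δ)` is finite"); and for some generator `g` of `D.charIdeal` and some
`u ∈ ℤ_p^×`,
`g(0) · #E(ℚ)² = u · #Ш_E(p) · #𝒦_{ℚ_v,0}[p^∞] · ∏_{ν≠p} c_ν` in `ℤ_p` — BOTH directions of Prop. 4's `∼`,
with `∏_{ν≠p} c_ν` the `finprod` of the tree's `tamagawaNumberAt` away from `p` (same term as both
sibling facts). No `_holds` (size L: Perrin-Riou / Coates–Greenberg control at an unstable prime,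
pp. 144–148).

**Dispute / scope note (honest; rides with the fact).** (1) De98 §2.2 Lemma (i) (p. 139) EVALUATES the
factor as `#𝔉(𝔽_p)(p)·#ℜE(ℚ_p)(p)`; that evaluation (used in §2.4 p. 148 and in Delbourgo 2002 p. 70)
is disputed on the anomalous rows — its printed proof takes the `Gal(L/ℚ_p)`-action on the special
fibre `𝔉` to be trivial at three places (cell record: `HOME/lit/delbourgo1998/STATEMENTS.md`, loci
⟦α⟧⟦β⟧⟦γ⟧; tree flag `Del02-ThmB-ellp-anomalous` in `Delbourgo2002/PAdicBSDLeadingTerm.lean`) — and is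
NOT transcribed here: the factor stays the ORDER OF A GROUP, as in Prop. 4's statement and proof
(p. 147 (iii)). (2) Inside the proof of Prop. 4 the Lemma of §2.2 is used for the FINITENESS of `Ker(δ)_𝔭`
(true under every reading) and, on p. 148, for the SURJECTIVITY of `δ` at `𝔭` through
"`H²(Γ, Ê_(𝔭)(ℚ_{∞,𝔭}))(p) = H²(ℚ_p, Ê_(𝔭))(p) = 0`" ("an easy consequence of the proof of our lemma in
Section 2.2 and the fact that `ℚ_{∞,𝔭}/ℚ_p` is deeply ramified") — the same dependency the accepted
sibling `prop4_rankZero_pow_dvd_constantCoeff` already carries; recorded for the referee's pre-audit,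
nothing is hidden in the statement. At `p = 3` with `d = 2 = p − 1` the Lemma's printed torsion bound
(locus ⟦δ⟧ of the cell record: "`v_L(x) ≤ v_L(℘_L)/(p − 1)`" for `v_L(p)/(p − 1)`) is a further printed
slip inside the same proof; the statement below, like its accepted siblings, is transcribed for every
odd `p` as printed (p. 123 "an odd rational prime"). (3) Rank `0` only ((Kol)); the (M) locus is the sibling
`…_of_potMult`; Delbourgo 2002 Theorem (B) (any rank, universal-norm currency) is
`Delbourgo2002.mainTheorem`.

## References
* D. Delbourgo, Compositio Math. 113 (1998) 123–154: §1.5 (G) (p. 130), §2.1 (p. 136), §2.2 (p. 138: control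
  diagram, `Ker(δ)` by inflation–restriction, Lemma for `ν ≠ p`; p. 139: Lemma (i)/(ii)), §2.3 (Kol) and
  Thm. 3 (p. 143), Prop. 4 (p. 144) with its proof (pp. 144–148). [Delbourgo1998]
* R. Greenberg, LNM 1716 (1999), §3 p. 86 (`r_{v_n}`), Lemma 3.4 (`|ker(r_{v_n})| = |Ẽ(f_{v_n})_p|²` at a
  GOOD ordinary `v`), Prop. 3.8 — the currency of the tree's `localTowerKer`. [GreenbergLNM1716]
-/

noncomputable section

open scoped Classical NumberField

open IsDedekindDomain NumberField WeierstrassCurve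

namespace Literature.NumberTheory.EllipticCurves.Delbourgo1998

/-- **Delbourgo 1998, Thm. 3 + Prop. 4 on the potentially good ORDINARY locus, EXACT up to a `p`-adic
unit, local factor at `p` intrinsic.** Let `W/ℚ` be a globally minimal elliptic curve, `p ≠ 2` a prime of
ADDITIVE reduction at which (G)-ordinary holds — for some `p`-th cyclotomic field `L ⊇ ℚ` and
intermediate field `F`, `E_F` has good reduction with unit root at every place of `F` above `p`; assume
`r_an(E) = 0` ((Kol)) and, as binders, `Ш(E/ℚ)` and `E(ℚ)` finite. Let `κ` be the cyclotomic
`ℤ_p`-extension of `ℚ`, `γ` a topological generator, `v` the place above `p`, `D` a Pontryagin-dual datum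
of `Sel_{p^∞}(E/ℚ_∞)`. Then `X(E/ℚ_∞)` is `Λ`-torsion (Thm. 3), the `p`-power torsion `𝒦_{ℚ_v,0}[p^∞]` of
the local restriction kernel `ker(H¹(ℚ_v, E(K̄_v)) → H¹(ℚ_vℚ_∞, E(K̄_v)))` is finite (p. 147 (iii)), and
the characteristic ideal has a generator `g` (the characteristic power series `G_E`) with
`g(0) · #E(ℚ)² = u · #Ш(E)(p) · #𝒦_{ℚ_v,0}[p^∞] · ∏_{ν≠p} c_ν` in `ℤ_p` for a unit `u ∈ ℤ_p^×` — Prop. 4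
`x_p^0(G_E) ∼ #Ш_E(p)·#E(ℚ)^{−2}·#H¹(ℚ_{∞,𝔭}/ℚ_p, E(ℚ_{∞,𝔭}))·∏_{ν≠p} c_ν` with the factor at `𝔭` read,
as printed on p. 138, as the `𝔭`-component of `Ker(δ)` ("The inflation-restriction sequence shows that
`Ker(δ) = ⊕_{ν∈Σ} H¹(ℚ_{∞,ν}/ℚ_ν, E(ℚ_{∞,ν}))(p)`"), i.e. the tree's `localTowerKerPrimary … 0`. The
VALUE of that factor (§2.2 Lemma (i)) is NOT part of the fact. No `_holds`.
[cite: Delbourgo1998, Prop. 4 (p. 144) and Thm. 3 (p. 143), with §2.2 p. 138 (Ker(δ) by inflation–restriction), p. 147 (iii), §1.5 (G) (p. 130), §2.1 (p. 136), §2.3 (Kol) (p. 143)] -/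
def prop4_rankZero_constantCoeff_eq_unit_mul_of_potGoodOrd : Prop :=
  ∀ (W : WeierstrassCurve ℚ) [W.IsElliptic] [W.IsGloballyMinimal] (p : ℕ) [Fact p.Prime],
    p ≠ 2 →
    (¬ W.HasGoodReductionAtPrime p ∧ ¬ W.HasMultiplicativeReductionAtPrime p) →
    (∃ (L : Type) (_ : Field L) (_ : NumberField L) (_ : IsCyclotomicExtension {p} ℚ L)
        (F : IntermediateField ℚ L),
        ∀ w : HeightOneSpectrum (𝓞 F), (p : 𝓞 F) ∈ w.asIdeal →
          (W.baseChange F).HasGoodReductionAt w ∧ (W.baseChange F).HasUnitRootAt w) →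
    W.analyticRank = 0 → Finite W.sha → Finite W.toAffine.Point →
    ∀ (κ : ZpExtension ℚ p) (γ : Field.absoluteGaloisGroup ℚ),
      κ.IsCyclotomic → κ.IsTopGenerator γ →
      ∀ (v : HeightOneSpectrum (𝓞 ℚ)), (p : 𝓞 ℚ) ∈ v.asIdeal →
      ∀ D : W.SelmerDualData κ γ,
        D.IsTorsion ∧
        Finite (W.localTowerKerPrimary κ (v.adicCompletion ℚ) 0) ∧
        ∃ g ∈ D.charIdeal, D.charIdeal = Ideal.span {g} ∧ ∃ u : ℤ_[p]ˣ,
          PowerSeries.constantCoeff g * ((Nat.card W.toAffine.Point : ℕ) : ℤ_[p]) ^ 2 =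
            (u : ℤ_[p]) * ((Nat.card (AddCommGroup.primaryComponent W.sha p) : ℕ) : ℤ_[p]) *
              ((Nat.card (W.localTowerKerPrimary κ (v.adicCompletion ℚ) 0) : ℕ) : ℤ_[p]) *
              ((∏ᶠ v : HeightOneSpectrum (𝓞 ℚ),
                  if (p : 𝓞 ℚ) ∈ v.asIdeal then 1 else W.tamagawaNumberAt v : ℕ) : ℤ_[p])

end Literature.NumberTheory.EllipticCurves.Delbourgo1998

end
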